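import Mathlib

/-!
# `GrenetZeon.DualUnipotentThreeHalves` (stmt-ValiantsHypothesis-24318), R2 heavy-top instrument — THEOREM C(7) PORT, KIT 2:
# a regular nilpotent matrix is conjugate to the full shift

Experiment cell «val-heavytop-census» (D-0160), engine seat val-htc-eng-1 g4.  Normalisation step of Theorem C(7) (lead g0 ROADMAP-codim1 §0,
«type `(m)`»): if `Z ∈ M_{m+1}(ℂ)` has `Z^{m+1} = 0` and `Z^m ≠ 0` then `P⁻¹ Z P = J` for an invertible `P`, where `J = Σ_i E_{i,i+1}` is the full
shift (`J_{ab} = [b = a + 1]`, the `hJ` convention of ✓ `HeavyTopStrictUpperOfJordan`).  Companion of ✓ `HeavyTopJordanShift.exists_isUnit_conj_eq_shift`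
(the subregular type `(m,1)`); same cyclic-vector proof without the extra kernel vector.

* `linearIndependent_cyclic_full` — `Z^{m+1} = 0`, `Z^m v ≠ 0` ⇒ `Z^m v, …, Zv, v` independent;
* ★ `exists_isUnit_conj_eq_fullShift` / `_apply` — the conjugation.

Honest framing: infrastructure (Jordan normal form of a regular nilpotent, folklore); nothing here proves or refutes `HeavyTopLaw`/`HeavyTopSlowLaw`,
24318, S3 or 8062; `VP ≠ VNP` is NOT proved.  No definitions.  [folklore; this seat, adapted from ✓ `HeavyTopJordanShift`]
-/

noncomputable section

-- single-conjunct layout: Sub = Summit, duplicated namespace component intended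
set_option linter.dupNamespace false
set_option autoImplicit false

namespace Summit.ValiantsHypothesis.ValiantsHypothesis.Theorems.GrenetZeon.HeavyTopThmCRegularShift

open Matrix

variable {m : ℕ}

/-- **The full cyclic family is independent**: `Z^{m+1} = 0`, `Z^m v ≠ 0` ⇒ `Z^m v, Z^{m−1} v, …, v` are linearly independent. [folklore] -/
theorem linearIndependent_cyclic_full (Z : Matrix (Fin (m + 1)) (Fin (m + 1)) ℂ) (v : Fin (m + 1) → ℂ) (hZ : Z ^ (m + 1) = 0)
    (hv : Z ^ m *ᵥ v ≠ 0) : LinearIndependent ℂ (fun i : Fin (m + 1) => Z ^ (m - (i : ℕ)) *ᵥ v) := by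
  rw [Fintype.linearIndependent_iff]
  intro g hg
  suffices H : ∀ n : ℕ, ∀ i : Fin (m + 1), (i : ℕ) + n = m → g i = 0 from fun i => H (m - i) i (by omega)
  intro n
  induction n using Nat.strong_induction_on with
  | _ n ih =>
    intro i₀ hi₀
    have h := congrArg (Matrix.mulVecLin (Z ^ (i₀ : ℕ))) hg
    rw [map_sum, map_zero] at h
    simp only [map_smul, Matrix.mulVecLin_apply, Matrix.mulVec_mulVec, ← pow_add] at h
    rw [Finset.sum_eq_single i₀] at h
    · rw [show (i₀ : ℕ) + (m - (i₀ : ℕ)) = m by omega] at h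
      exact (smul_eq_zero.1 h).resolve_right hv
    · intro i _ hi
      by_cases hlt : (i : ℕ) < i₀
      · rw [pow_eq_zero_of_le (by omega : m + 1 ≤ (i₀ : ℕ) + (m - (i : ℕ))) hZ, Matrix.zero_mulVec, smul_zero]
      · have hne : (i : ℕ) ≠ i₀ := fun e => hi (Fin.ext e)
        rw [ih (m - i) (by omega) i (by omega), zero_smul]
    · intro h'
      exact absurd (Finset.mem_univ _) h'

/-- ★ **JORDAN FORM OF A REGULAR NILPOTENT.**  If `Z ∈ M_{m+1}(ℂ)` satisfies `Z^{m+1} = 0` and `Z^m ≠ 0`, then `P⁻¹ Z P = J` with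
`J_{ab} = [b = a + 1]` for an invertible `P` (columns `Z^m v, …, Zv, v`). [folklore (Jordan); this file] -/
theorem exists_isUnit_conj_eq_fullShift (Z : Matrix (Fin (m + 1)) (Fin (m + 1)) ℂ) (hZ : Z ^ (m + 1) = 0) (hZm : Z ^ m ≠ 0) :
    ∃ P : Matrix (Fin (m + 1)) (Fin (m + 1)) ℂ, IsUnit P ∧
      P⁻¹ * Z * P = Matrix.of fun a b : Fin (m + 1) => if (b : ℕ) = a + 1 then (1 : ℂ) else 0 := by
  classical
  -- a vector with `Z^m v ≠ 0`
  obtain ⟨v, hv⟩ : ∃ v : Fin (m + 1) → ℂ, Z ^ m *ᵥ v ≠ 0 := by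
    by_contra h
    push Not at h
    apply hZm
    ext i j
    have := congrFun (h (Pi.single j 1)) i
    simpa [Matrix.mulVec, dotProduct, Pi.single_apply] using this
  let b : Fin (m + 1) → (Fin (m + 1) → ℂ) := fun j => Z ^ (m - (j : ℕ)) *ᵥ v
  have hbli : LinearIndependent ℂ b := linearIndependent_cyclic_full Z v hZ hv
  -- the basis and the change-of-basis matrix
  let bB : Module.Basis (Fin (m + 1)) ℂ (Fin (m + 1) → ℂ) :=
    basisOfLinearIndependentOfCardEqFinrank hbli (by rw [Module.finrank_fintype_fun_eq_card])
  have hbB : ∀ j, bB j = b j := fun j =>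
    congrFun (coe_basisOfLinearIndependentOfCardEqFinrank hbli (by rw [Module.finrank_fintype_fun_eq_card])) j
  set P : Matrix (Fin (m + 1)) (Fin (m + 1)) ℂ := (Pi.basisFun ℂ (Fin (m + 1))).toMatrix bB with hPdef
  have hP : ∀ i j, P i j = b j i := fun i j => by
    rw [hPdef, Module.Basis.toMatrix_apply, Pi.basisFun_repr, hbB]
  have hS : P * bB.toMatrix (Pi.basisFun ℂ (Fin (m + 1))) = 1 := Module.Basis.toMatrix_mul_toMatrix_flip _ _
  have hS' : bB.toMatrix (Pi.basisFun ℂ (Fin (m + 1))) * P = 1 := Module.Basis.toMatrix_mul_toMatrix_flip _ _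
  have hPunit : IsUnit P := ⟨⟨P, _, hS, hS'⟩, rfl⟩
  -- `Z b_j = b_{j-1}` (`j ≥ 1`), `Z b_0 = 0`
  have hZb : ∀ j : Fin (m + 1), Z *ᵥ b j = if h : 1 ≤ (j : ℕ) then b ⟨(j : ℕ) - 1, by omega⟩ else 0 := by
    intro j
    by_cases hj1 : 1 ≤ (j : ℕ)
    · rw [dif_pos hj1]
      simp only [b]
      rw [Matrix.mulVec_mulVec, ← pow_succ', show m - (j : ℕ) + 1 = m - ((j : ℕ) - 1) by omega]
    · rw [dif_neg hj1]
      simp only [b]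
      rw [Matrix.mulVec_mulVec, ← pow_succ', show m - (j : ℕ) + 1 = m + 1 by omega, hZ, Matrix.zero_mulVec]
  -- `Z P = P J`
  have hZP : Z * P = P * Matrix.of fun a c : Fin (m + 1) => if (c : ℕ) = a + 1 then (1 : ℂ) else 0 := by
    ext r j
    have lhs : (Z * P) r j = (Z *ᵥ b j) r := by
      simp only [Matrix.mul_apply, Matrix.mulVec, dotProduct, hP]
    rw [lhs, hZb j, Matrix.mul_apply]
    by_cases h : 1 ≤ (j : ℕ)
    · rw [dif_pos h, Finset.sum_eq_single ⟨(j : ℕ) - 1, by omega⟩]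
      · rw [hP, Matrix.of_apply, if_pos (by simp; omega), mul_one]
      · intro k _ hk
        have hne : (k : ℕ) ≠ j - 1 := fun e => hk (Fin.ext e)
        rw [Matrix.of_apply, if_neg (by omega), mul_zero]
      · intro h'
        exact absurd (Finset.mem_univ _) h'
    · rw [dif_neg h, Pi.zero_apply]
      symm
      refine Finset.sum_eq_zero fun k _ => ?_
      rw [Matrix.of_apply, if_neg (by omega), mul_zero]
  refine ⟨P, hPunit, ?_⟩
  have hPdet : IsUnit P.det := (Matrix.isUnit_iff_isUnit_det P).1 hPunit
  rw [Matrix.mul_assoc, hZP, ← Matrix.mul_assoc, Matrix.nonsing_inv_mul P hPdet, Matrix.one_mul]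

/-- Entry form of ✓ `exists_isUnit_conj_eq_fullShift`, matching the `hJ` convention `J i j = if j.val = i.val + 1 then 1 else 0`. [this file] -/
theorem exists_isUnit_conj_apply_eq_fullShift (Z : Matrix (Fin (m + 1)) (Fin (m + 1)) ℂ) (hZ : Z ^ (m + 1) = 0) (hZm : Z ^ m ≠ 0) :
    ∃ P : Matrix (Fin (m + 1)) (Fin (m + 1)) ℂ, IsUnit P ∧
      ∀ i j : Fin (m + 1), (P⁻¹ * Z * P) i j = if (j : ℕ) = i + 1 then (1 : ℂ) else 0 := by
  obtain ⟨P, hP, h⟩ := exists_isUnit_conj_eq_fullShift Z hZ hZm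
  exact ⟨P, hP, fun i j => by rw [h, Matrix.of_apply]⟩

end Summit.ValiantsHypothesis.ValiantsHypothesis.Theorems.GrenetZeon.HeavyTopThmCRegularShift

end
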